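/-
Copyright (c) 2026 the pub-hodgecm-mathlib formalisation cell (harness21).  Prover seat hodgecm-mathlib-K2Liu-p09 (g6): Track B «K2-LIT»,
hLiu418 = stmt-HodgeConjecture-24832; LEAD F0P6-plan RULINGS M-156m∕M-157q, file V1c of the A7-val census (the `hintA` binder of ★ V1 at `n = 2`).
-/
import Summits.HodgeConjecture.HodgeConjecture.Theorems.K2LiuA7NormalisedRegularityCM   -- ★ B8-CM `exists_adaptedFrame` (+ ★ B7, B7s, B7-M2, B7-M2s, B4d-3, B7-R)
import HarnessLib

/-!
# Crux `HLiu418`, road `K2_Liu`, organ A7-val, file V1c: THE SIEGEL INTERTWINING INTEGRAND OF A SMOOTH SIEGEL SECTION IS INTEGRABLE ON `1 < re s`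
# (`n = 2`, every finite place; the `hintA` binder of ★ V1 `K2LiuA7ValueFunctional.value_translate`)

Cell `hodgecm-mathlib`, crux item hLiu418 = `stmt-HodgeConjecture-24832`; squad K2 ∕ K2Liu; prover K2Liu-p09 (g6).  THEOREMS ONLY; lane
`--supports stmt-HodgeConjecture-24832` (count-neutral helper).
THE POINT.  ★ D10 `localIntertwining νN f h := ∫ f(w_Δ u h) dνN(u)` is a Bochner integral (junk `0` off integrability), so every LINEARITY statement about
`M_v(s)` (★ `localIntertwining_smul_add`, ★ V1 `value_eq_sum`) carries an integrability binder.  For a SMOOTH SIEGEL SECTION `f ∈ I_v(s, χ_v)`, `χ_v` unitary,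
`1 < re s`, and every `h`, **`u ↦ f(w_Δ u h)` is `νN`-integrable**: the majorant chains ★ B7-M2 `chain_integrability_of_forall_eq` (one place of `E` above `v`) ∕
★ B7-M2s `chain_integrability_of_pair` (two places) feed ★ B4d-3 `integral_frameConj_weylSiegel_eq_iterated_of_chain`, whose first component is the integrability of
`u ↦ f(φ(w_Δ^J) u h)`; and `w_Δ = m₀ · φ(w_Δ^J)` with `m₀ ∈ P_Δ(F_v)` (★ B4d-3 `weylDelta_eq_mul_frameConj_weylSiegel`) turns it into the `w_Δ`-integrand up to the
scalar `χ_s(m₀)`.  FRAME-FREE: the Δ-adapted frame is discharged by ★ B8-CM §1 `exists_adaptedFrame` from `IsUnit (det T₂)`; the two cases by ★ B7-R `placesOver_cases'`.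
HONEST LABEL.  `HC_CM` is proved only modulo the 7 printed citations (2 remaining named inputs: hLiu418 = `stmt-HodgeConjecture-24832`,
h413 = `stmt-HodgeConjecture-24833`) until rung 0 closes.

## References
* [KudlaSweet1997] S. Kudla, W. J. Sweet, Israel J. Math. 98 (1997), §1 (absolute convergence of `M(s)` on `re s > ρ`; majorant `|f| ∈ I(re s, 1)`).
* [Casselman1980] W. Casselman, Compositio Math. 40 (1980), §3 Thm. 3.1.
* [HarrisKudlaSweet1996] M. Harris, S. Kudla, W. J. Sweet, J. AMS 9 (1996), §1 (1.11)–(1.12), §6 (6.14).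
-/

set_option autoImplicit false
set_option linter.dupNamespace false -- the mandated namespace repeats `HodgeConjecture.HodgeConjecture`

noncomputable section

open scoped Classical NNReal ENNReal
open NumberField IsDedekindDomain Matrix MeasureTheory Topology
open Literature.NumberTheory.GaloisRepresentations.IsNonarchimedeanLocalField
open Literature.NumberTheory.Automorphic Literature.NumberTheory.Automorphic.UnitaryGroup
open Literature.NumberTheory.GelbartRogawski1991.AdaptedBlocks
open Literature.NumberTheory.GelbartRogawski1991.UnitaryDualPair.LocalSplitting
open Literature.NumberTheory.K2Lit.LocalSiegelDoubled
open Summit.HodgeConjecture.HodgeConjecture.Cruxes.HLiu418.K2LiuLocalSiegelIwasawaFrame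
open Summit.HodgeConjecture.HodgeConjecture.Cruxes.HLiu418.K2LiuLocalSiegelIwasawa
open Summit.HodgeConjecture.HodgeConjecture.Cruxes.HLiu418.K2LiuDoubledUTwoTwoBorelFrame
open Summit.HodgeConjecture.HodgeConjecture.Cruxes.HLiu418.K2LiuDoubledUTwoTwoWeylCocycle
open Summit.HodgeConjecture.HodgeConjecture.Cruxes.HLiu418.K2LiuDoubledUTwoTwoFrameTransport
open Summit.HodgeConjecture.HodgeConjecture.Cruxes.HLiu418.K2LiuDoubledUTwoTwoUnipotentHaar
open Summit.HodgeConjecture.HodgeConjecture.Cruxes.HLiu418.K2LiuDoubledUTwoTwoLeviTransport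
open Summit.HodgeConjecture.HodgeConjecture.Cruxes.HLiu418.K2LiuUnipDeltaRankOneCoordinates
open Summit.HodgeConjecture.HodgeConjecture.Cruxes.HLiu418.K2LiuSiegelIntertwiningCocycle
open Summit.HodgeConjecture.HodgeConjecture.Cruxes.HLiu418.K2LiuLocalRingPlaceDecomposition
open Summit.HodgeConjecture.HodgeConjecture.Cruxes.HLiu418.K2LiuA7NormalisedRegularitySetup
open Summit.HodgeConjecture.HodgeConjecture.Cruxes.HLiu418.K2LiuA7NormalisedRegularityMajorant
open Summit.HodgeConjecture.HodgeConjecture.Cruxes.HLiu418.K2LiuA7NormalisedRegularityMajorantSplit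
open Summit.HodgeConjecture.HodgeConjecture.Cruxes.HLiu418.K2LiuA7NormalisedRegularityCM

namespace Summit.HodgeConjecture.HodgeConjecture.Cruxes.HLiu418.K2LiuSiegelIntertwiningIntegrable

variable (F : Type) [Field F] [NumberField F] (E : Type) [Field E] [NumberField E] [Algebra F E]
  [Algebra.IsQuadraticExtension F E] (c : E ≃ₐ[F] E)
  {δ : E} (hcδ : c δ = -δ) (hδ : δ ≠ 0) {d : F} (hd : δ * δ = algebraMap F E d) (v : HeightOneSpectrum (𝓞 F))
  {T₂ : Matrix (Fin 2) (Fin 2) F} (hT₂ : T₂.IsSymm) {J₂D : Matrix (Fin (2 + 2)) (Fin (2 + 2)) E} (hJ₂D : J₂D = (gramD F 2 T₂).map (algebraMap F E))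

/-! ## §1 With the frame as binders -/

section Framed

variable (D Dinv : Matrix (Fin 2) (Fin 2) F) (hDD : D * Dinv = 1) (hDD' : Dinv * D = 1) (Q : GL (Fin (2 + 2)) F)
  (hQm : (Q : Matrix (Fin (2 + 2)) (Fin (2 + 2)) F) = Matrix.reindex (e₂ 2) (e₂ 2) (Matrix.fromBlocks 1 D 1 (-D)))
  (hQ : (Q : Matrix (Fin (2 + 2)) (Fin (2 + 2)) F)ᵀ * gramD F 2 T₂ * (Q : Matrix (Fin (2 + 2)) (Fin (2 + 2)) F) = (StdForm.antidiagonal (2 + 2)).over F)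

include hcδ hδ hd hT₂ hDD hDD' hQm hQ in
/-- **the `φ(w_Δ^J)`-integrand is integrable** (`1 < re s`, `χ_v` unitary, `f` a smooth Siegel section): ★ B7-M2 ∕ ★ B7-M2s feed ★ B4d-3's first component,
in the Δ-adapted frame. [cite: KudlaSweet1997, §1] [cite: Casselman1980, §3 Thm. 3.1] -/
theorem integrable_frameConj_weylSiegel_mul
    [MeasurableSpace (unipDeltaLocal F E c v 2 (JD := J₂D))] [BorelSpace (unipDeltaLocal F E c v 2 (JD := J₂D))]
    (νN : Measure (unipDeltaLocal F E c v 2 (JD := J₂D))) [νN.IsHaarMeasure]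
    {χv : ∀ w : PlacesOver E v, (w.1.adicCompletion E)ˣ →* ℂˣ} (hχ : ∀ (w' : PlacesOver E v) (x : (w'.1.adicCompletion E)ˣ), ‖((χv w' x : ℂˣ) : ℂ)‖ = 1)
    {s : ℂ} (hs : 1 < s.re) {f₀ : UnitaryGroup.localPi E c (2 + 2) J₂D v → ℂ} (hf₀ : IsLocalSiegelSection F E c hcδ hδ hd v 2 hT₂ hJ₂D χv s f₀) (hsm₀ : IsSmooth F E c v 2 f₀)
    (h : UnitaryGroup.localPi E c (2 + 2) J₂D v) :
    Integrable (fun u : unipDeltaLocal F E c v 2 (JD := J₂D) => f₀ (FrameTransport.frameConj F E c v (2 + 2) hJ₂D (antidiagonal_over_eq_map F E 2) Q hQ (toLocalFour F E c v (weylSiegel (UnitaryGroup.LocalRing E v) (UnitaryGroup.conjLocal E c v))) * (u : UnitaryGroup.localPi E c (2 + 2) J₂D v) * h)) νN := by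
  -- topology and measures
  haveI := secondCountableTopology_adicCompletion F v
  haveI : ∀ w' : PlacesOver E v, SecondCountableTopology (w'.1.adicCompletion E) := fun w' => secondCountableTopology_adicCompletion E w'.1
  obtain ⟨K', hK'⟩ := hsm₀
  -- the coordinates of `N_Δ(F_v)`
  obtain ⟨e3, he3'⟩ := exists_homeomorph_coordTwo F E c hcδ hδ v hJ₂D D Dinv hDD hDD' Q hQm hQ
  have he3 := he3'.1
  rcases placesOver_cases' F E c v hcδ hδ with ⟨w, hw⟩ | ⟨w₁, w₂, hne, hw⟩
  · -- one place above `v`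
    borelize (v.adicCompletion F) (w.1.adicCompletion E) (UnitaryGroup.LocalRing E v)
    obtain ⟨μF, hμF⟩ : ∃ μ : Measure (v.adicCompletion F), μ.IsAddHaarMeasure := ⟨Measure.addHaar, inferInstance⟩
    obtain ⟨μw, hμw⟩ : ∃ μ : Measure (w.1.adicCompletion E), μ.IsAddHaarMeasure := ⟨Measure.addHaar, inferInstance⟩
    obtain ⟨e₁, he₁, he₁add⟩ := exists_homeomorph_single_of_forall_eq F E v w hw
    haveI hμR : (Measure.map (⇑e₁) μw).IsAddHaarMeasure :=
      AddEquiv.isAddHaarMeasure_map μw ({ toFun := e₁, invFun := e₁.symm, left_inv := e₁.symm_apply_apply, right_inv := e₁.apply_symm_apply, map_add' := he₁add } :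
        w.1.adicCompletion E ≃+ UnitaryGroup.LocalRing E v) e₁.continuous e₁.symm.continuous
    obtain ⟨cN, -, hν⟩ := exists_measure_eq_smul_map F E c v e3 he3'.2 νN μF (Measure.map (⇑e₁) μw)
    obtain ⟨A, hA⟩ := exists_partialWeylGL F E v w
    have hch := chain_integrability_of_forall_eq F E c hcδ hδ hd v hT₂ hJ₂D D Dinv hDD Q hQm hQ μF e3 he3 hχ hs hf₀ ⟨K', hK'⟩ K' hK' w hw μw e₁ he₁ A hA h
    exact (integral_frameConj_weylSiegel_eq_iterated_of_chain F E c hcδ hδ v hJ₂D Q hQ e3 he3 νN μF (Measure.map (⇑e₁) μw) cN hν f₀ h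
      hch.1 hch.2.1 hch.2.2.1 hch.2.2.2).1
  · -- two places above `v`
    borelize (v.adicCompletion F) (w₁.1.adicCompletion E) (w₂.1.adicCompletion E) (UnitaryGroup.LocalRing E v)
    obtain ⟨μF, hμF⟩ : ∃ μ : Measure (v.adicCompletion F), μ.IsAddHaarMeasure := ⟨Measure.addHaar, inferInstance⟩
    obtain ⟨μ₁, hμ₁⟩ : ∃ μ : Measure (w₁.1.adicCompletion E), μ.IsAddHaarMeasure := ⟨Measure.addHaar, inferInstance⟩
    obtain ⟨μ₂, hμ₂⟩ : ∃ μ : Measure (w₂.1.adicCompletion E), μ.IsAddHaarMeasure := ⟨Measure.addHaar, inferInstance⟩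
    haveI hμ12 : (μ₁.prod μ₂).IsAddHaarMeasure := Measure.prod.instIsAddHaarMeasure μ₁ μ₂
    obtain ⟨e₂, he₂, he₂add⟩ := exists_homeomorph_single_add_single F E v w₁ w₂ hne hw
    haveI hμR : (Measure.map (⇑e₂) (μ₁.prod μ₂)).IsAddHaarMeasure :=
      AddEquiv.isAddHaarMeasure_map (μ₁.prod μ₂) ({ toFun := e₂, invFun := e₂.symm, left_inv := e₂.symm_apply_apply, right_inv := e₂.apply_symm_apply, map_add' := he₂add } :
        (w₁.1.adicCompletion E × w₂.1.adicCompletion E) ≃+ UnitaryGroup.LocalRing E v) e₂.continuous e₂.symm.continuous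
    obtain ⟨cN, -, hν⟩ := exists_measure_eq_smul_map F E c v e3 he3'.2 νN μF (Measure.map (⇑e₂) (μ₁.prod μ₂))
    obtain ⟨A₁, hA₁⟩ := exists_partialWeylGL F E v w₁
    obtain ⟨A₂, hA₂⟩ := exists_partialWeylGL F E v w₂
    have hch := chain_integrability_of_pair F E c hcδ hδ hd v hT₂ hJ₂D D Dinv hDD Q hQm hQ μF e3 he3 hχ hs hf₀ ⟨K', hK'⟩ K' hK' w₁ w₂ hne hw μ₁ μ₂ e₂ he₂ A₁ hA₁ A₂ hA₂ h
    exact (integral_frameConj_weylSiegel_eq_iterated_of_chain F E c hcδ hδ v hJ₂D Q hQ e3 he3 νN μF (Measure.map (⇑e₂) (μ₁.prod μ₂)) cN hν f₀ h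
      hch.1 hch.2.1 hch.2.2.1 hch.2.2.2).1

include hcδ hδ hd hT₂ hDD hDD' hQm hQ in
/-- **the `w_Δ`-integrand is integrable** (`w_Δ = m₀ · φ(w_Δ^J)`, `m₀ ∈ P_Δ(F_v)`, so the integrand is `χ_s(m₀)` times the `φ(w_Δ^J)`-integrand). [cite: KudlaSweet1997, §1] -/
theorem integrable_weylDelta_mul_framed
    [MeasurableSpace (unipDeltaLocal F E c v 2 (JD := J₂D))] [BorelSpace (unipDeltaLocal F E c v 2 (JD := J₂D))]
    (νN : Measure (unipDeltaLocal F E c v 2 (JD := J₂D))) [νN.IsHaarMeasure]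
    {χv : ∀ w : PlacesOver E v, (w.1.adicCompletion E)ˣ →* ℂˣ} (hχ : ∀ (w' : PlacesOver E v) (x : (w'.1.adicCompletion E)ˣ), ‖((χv w' x : ℂˣ) : ℂ)‖ = 1)
    {s : ℂ} (hs : 1 < s.re) {f₀ : UnitaryGroup.localPi E c (2 + 2) J₂D v → ℂ} (hf₀ : IsLocalSiegelSection F E c hcδ hδ hd v 2 hT₂ hJ₂D χv s f₀) (hsm₀ : IsSmooth F E c v 2 f₀)
    (h : UnitaryGroup.localPi E c (2 + 2) J₂D v) :
    Integrable (fun u : unipDeltaLocal F E c v 2 (JD := J₂D) => f₀ (weylDelta F E c v 2 hJ₂D (T₀ := T₂) * (u : UnitaryGroup.localPi E c (2 + 2) J₂D v) * h)) νN := by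
  have hI := (integrable_frameConj_weylSiegel_mul F E c hcδ hδ hd v hT₂ hJ₂D D Dinv hDD hDD' Q hQm hQ νN hχ hs hf₀ hsm₀ h).const_mul
    (localSiegelCharacter F E c v 2 χv s (weylDelta F E c v 2 hJ₂D (T₀ := T₂) * FrameTransport.frameConj F E c v (2 + 2) hJ₂D (antidiagonal_over_eq_map F E 2) Q hQ (toLocalFour F E c v (weylSiegel (UnitaryGroup.LocalRing E v) (UnitaryGroup.conjLocal E c v)))))
  refine hI.congr (Filter.Eventually.of_forall fun u => Eq.symm ?_)
  show f₀ (weylDelta F E c v 2 hJ₂D (T₀ := T₂) * (u : UnitaryGroup.localPi E c (2 + 2) J₂D v) * h) = localSiegelCharacter F E c v 2 χv s _ * f₀ _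
  conv_lhs => rw [weylDelta_eq_mul_frameConj_weylSiegel F E c v hJ₂D Q hQ]
  rw [mul_assoc, mul_assoc, hf₀ _ (isSiegelDelta_weylDelta_mul_frameConj_weylSiegel F E c hcδ hδ hd v hT₂ hJ₂D D Dinv hDD Q hQm hQ), ← mul_assoc]

end Framed

/-! ## §2 Frame-free: `IsUnit (det T₂)` -/

include hcδ hδ hd hT₂ in
/-- **THE SIEGEL INTERTWINING INTEGRAND OF A SMOOTH SIEGEL SECTION IS INTEGRABLE** on `1 < re s` (`χ_v` unitary, `det T₂` a unit, `n = 2`, every finite place `v`):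
`u ↦ f(w_Δ u h) ∈ L¹(N_Δ(F_v), νN)` — the `hintA` binder of ★ V1 `value_translate` at `n = 2` (frame by ★ B8-CM `exists_adaptedFrame`).
[cite: KudlaSweet1997, §1] [cite: Casselman1980, §3 Thm. 3.1] [cite: HarrisKudlaSweet1996, §6 (6.14)] -/
theorem integrable_weylDelta_mul (hT₂d : IsUnit T₂.det)
    [MeasurableSpace (unipDeltaLocal F E c v 2 (JD := J₂D))] [BorelSpace (unipDeltaLocal F E c v 2 (JD := J₂D))]
    (νN : Measure (unipDeltaLocal F E c v 2 (JD := J₂D))) [νN.IsHaarMeasure]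
    {χv : ∀ w : PlacesOver E v, (w.1.adicCompletion E)ˣ →* ℂˣ} (hχ : ∀ (w' : PlacesOver E v) (x : (w'.1.adicCompletion E)ˣ), ‖((χv w' x : ℂˣ) : ℂ)‖ = 1)
    {s : ℂ} (hs : 1 < s.re) {f₀ : UnitaryGroup.localPi E c (2 + 2) J₂D v → ℂ} (hf₀ : IsLocalSiegelSection F E c hcδ hδ hd v 2 hT₂ hJ₂D χv s f₀) (hsm₀ : IsSmooth F E c v 2 f₀)
    (h : UnitaryGroup.localPi E c (2 + 2) J₂D v) :
    Integrable (fun u : unipDeltaLocal F E c v 2 (JD := J₂D) => f₀ (weylDelta F E c v 2 hJ₂D (T₀ := T₂) * (u : UnitaryGroup.localPi E c (2 + 2) J₂D v) * h)) νN := by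
  obtain ⟨D, Dinv, Q, hDD, hDD', hQm, hQ⟩ := exists_adaptedFrame F 2 hT₂ hT₂d
  exact integrable_weylDelta_mul_framed F E c hcδ hδ hd v hT₂ hJ₂D D Dinv hDD hDD' Q hQm hQ νN hχ hs hf₀ hsm₀ h

end Summit.HodgeConjecture.HodgeConjecture.Cruxes.HLiu418.K2LiuSiegelIntertwiningIntegrable

end
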